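import Summits.BirchSwinnertonDyer.Rank1Residual.ManinAdditive.ShimuraFiveEleven
import Summits.BirchSwinnertonDyer.BirchSwinnertonDyer.Theorems.ManinLocalTwoThreeShimuraFiveTransport
import HarnessLib

/-!
# The es g43 rows E-es-221/222/223/225 discharged by name (cell bsd-f2-manin; MEMO-es §65)

Route `ManinLocalTwoThree`, crux C2 `ManinOddAtFour` stmt-BirchSwinnertonDyer-22967 (helper).  Closes the `@[conjecture]` rows of
`Rank1Residual/ManinAdditive/ShimuraFiveEleven.lean` that are theorems: E-es-221 `ElevenDividesLevelOfShimuraFive`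
(⟸ `ShimuraFive.eleven_dvd_level_of_not_shimuraIndexPrimeTo_five`), E-es-225/222 `PrimeLevelShimuraExponentLawAll` / `PrimeLevelShimuraExponentLaw`
(⟸ `ShimuraFive.two_mul_mem_or_three_mul_mem_primeLevel_of_ne'`), E-es-223 `OddLevelFiveAtTwoTrivialKernel`
(⟸ `ShimuraFive.periodLattice_le_gamma1_of_frobeniusTrace_two_eq_neg_two`).  E-es-224
`ShimuraFiveOnlyAtEleven` stays OPEN (conjectural on `{5 ∣ N} ∪ {p² ∣ N}`).

HONEST FRAMING: unconditional tree theorems (standard axioms); no definitions, no named facts, no sorry.  C2, C3, E-es-224, Manin's conjecture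
and BSD are NOT proved by this file. [cite: Vatsal2005, Rem. 1.8] [cite: ByeonKim2014, Thm. 1.1] [cite: DerickxOrlic2025, Rmk. 4.8]
-/

set_option autoImplicit false
-- lint-debt: the directory name repeats the summit name (sibling precedent `ManinLocalTwoThreeShimuraFiveTransport.lean`)
set_option linter.dupNamespace false

noncomputable section

open scoped MatrixGroups ModularForm

open CongruenceSubgroup Complex WeierstrassCurve Literature.NumberTheory.EllipticCurves
  Literature.NumberTheory.EllipticCurves.ModularForms
open Summit.BirchSwinnertonDyer.Rank1Residual.ManinAdditive Summit.BirchSwinnertonDyer.Rank1Residual.ManinAdditive.KatoCurve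
open Summit.BirchSwinnertonDyer.Rank1Residual.ManinAdditive.EsG43
open Summit.BirchSwinnertonDyer.BirchSwinnertonDyer.Theorems.ManinLocalTwoThree

namespace Summit.BirchSwinnertonDyer.BirchSwinnertonDyer.Theorems.ManinLocalTwoThree.ShimuraFiveEleven

/-- E-es-221 holds. -/
theorem elevenDividesLevelOfShimuraFive_holds : ElevenDividesLevelOfShimuraFive :=
  fun W₀ _ _ _ _ D₀ hopt hS ↦ ShimuraFive.eleven_dvd_level_of_not_shimuraIndexPrimeTo_five W₀ D₀ hopt hS

/-- E-es-225 holds (no lattice-optimality binder). -/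
theorem primeLevelShimuraExponentLawAll_holds : PrimeLevelShimuraExponentLawAll :=
  fun W _ _ _ _ D hq h11 h17 ↦ ShimuraFive.two_mul_mem_or_three_mul_mem_primeLevel_of_ne' W D hq h11 h17

/-- E-es-222 holds. -/
theorem primeLevelShimuraExponentLaw_holds : PrimeLevelShimuraExponentLaw :=
  primeLevelShimuraExponentLaw_of_all primeLevelShimuraExponentLawAll_holds

/-- E-es-223 holds. -/
theorem oddLevelFiveAtTwoTrivialKernel_holds : OddLevelFiveAtTwoTrivialKernel :=
  fun W₀ _ _ _ _ D₀ hopt hN2 hN11 ha ↦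
    ShimuraFive.periodLattice_le_gamma1_of_frobeniusTrace_two_eq_neg_two W₀ D₀ hopt hN2 hN11 ha

end Summit.BirchSwinnertonDyer.BirchSwinnertonDyer.Theorems.ManinLocalTwoThree.ShimuraFiveEleven

end
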